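import Literature.MathematicalPhysics.QuantumFieldTheory.Balaban1983to89.B3WT228Graphs

/-
Copyright: statement-level skeleton of a published paper (lit-balaban cell, Phase-2 proof seat p39 gen 14). No proof claims
beyond what the kernel checks below.
-/

/-!
# B3 — T. Bałaban, *(Higgs)₂,₃ quantum fields in a finite volume. III. Renormalization*, CMP **88** (1983) 411–445
[Balaban1983Higgs3], p. 431 after (2.28): **"Taking other functions F … we can get all necessary Ward–Takahashi identities" —
THE IDENTITY FOR `F(φ) = :|φ(x)|²:` (the functions `−½δm²_l(x):|φ(x)|²:`, `−λ_kC^η_{M²}(0):|φ(x)|²:` of p. 430) DRAWN ON THE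
CONCRETE LATTICE MODEL**: the one-loop graphs with a two-leg vertex inserted at `x` — the (2.27) pictures with the insertion on a
scalar line — summed with the printed coefficients vanish, for every site `x`

statement-level skeleton of published theorems with citation tags; proofs where landed; nothing here is a claim about
the Yang–Mills mass gap

PDF held: `paper:balaban1983-higgs-2-3-quantum-fields-finite-volume` (journal page = PDF page + 410); pp. 430–431 [PDF 20–21]
read on the ×4 renders `run/shared/lean/pub/pub-balaban/b2b-balaban-ref1/pages/1983-cmp88-higgs23-III/…-p020-x4.png`, `…-p021-x4.png`.

CITATION HEADER (lean-in-tree rule).  Part of the lit-balaban TYPED SKELETON (HOME `run/shared/lean/pub/lit-balaban/`), PHASE 2,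
proof seat p39 (generation 14).  Row **B3.Eq2.26-2.28** of `HOME/lit-balaban-r15/ROWS-B3.md` (fold owner r15).  Sequel of
`B3WickVertexCalculus` (the Wick-ordered vertex `:|φ(x)|²: = wick2`, contraction rule `integral_wick2_mul`) and `B3WT228Graphs`
(derivatives of the bilinear vertices `derivAlong_biq`/`derivAlong_dbiq`, growth of the pairings); the LEFT member is gen-13's
`B3WT228Left.eq228_deriv` (every local even polynomial `F`), the model and the pairings `curJ`, `pairD`, `locQ`, `derQ` as there.

THE PRINTED TEXT (verbatim, pp. 430–431).  *"[F(φ) is chosen as a polynomial, e.g. we can take F(φ) = −λ_k:|φ(x)|⁴:, or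
F(φ) = −½δm²_l(x):|φ(x)|²:, or F(φ) = −λ_kC^η_{M²}(0):|φ(x)|²:], we get a set of Ward-Takahashi identities. … Taking other
functions F, or differentiating (2.24) to higher order in A, we can get all necessary Ward-Takahashi identities. … Each such identity
is connected with some set of graphs."*

WHAT IS PROVED (theorems only; no definition, no `Prop`; standard axioms; `τ := tr q² = trE(q∘q)`, `Z = ∫W`, `C = C^η_{M²}`).
* §1 the one-loop Gaussian evaluations with the `:|φ(x)|²:` insertion: `integral_wick2_biq` —
  `∫W :|φ(x)|²:⟪φ(y),Qφ(y')⟫ = 2C(y,x)C(y',x)·tr Q·Z` (the tadpole line of the seagull opened at `x`); `moment2_lin_comb` (four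
  covariances); `sum_integral_dJ_mul_dJ` and **`integral_wick2_JJ`** —
  `∫W :|φ(x)|²:⟪φ(y₁),qφ(y₂)⟫⟪φ(y₃),qφ(y₄)⟫ = −2τZ·[C(y₁,x)C(y₃,x)C(y₂,y₄) − C(y₁,x)C(y₄,x)C(y₂,y₃) − C(y₂,x)C(y₃,x)C(y₁,y₄) + C(y₂,x)C(y₄,x)C(y₁,y₃)]`
  (the two-propagator loop of (2.26), `B3WTWick.moment_qq`, with each line in turn opened at `x`).
* §2 `eq228_phi2_left` — the LEFT member for `F = :|φ(x)|²:`: `∫W :|φ(x)|²:[(−cηe⟨∂^ηφ,Bqφ⟩)⟨∂^ηφ,∂^ηλqφ⟩ − cηe⟨φ,B·∂^ηλq²φ⟩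
  − ηe⟨∂^ηφ,B∂^ηλq²φ⟩] = 0` (`eq228_deriv` with `α = 0`, `β = 𝟙_{x}`, `γ = −N·C(x,x)𝟙_{x}`).
* §3 `eq228_phi2_wick` — its Gaussian evaluation as `Z` times the explicit sum of one-loop graphs `phi2Graphs` spelled out in the
  statement (triangle graphs through `x` from the two current vertices; seagull tadpoles opened at `x`), and
  **`eq228_phi2` — THE DRAWN IDENTITY: that sum of graphs is `0` for every site `x`, direction `B` and gauge function `λ`.**
Honest scope: propagators `C^η_{M²}` at `A = 0` on the model torus; the identity is stated sitewise in `x` (the print's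
`F = −½Σδm²_l(x):|φ(x)|²:` is the `δm²_l`-weighted sum of these); "higher order in A" is not done.  Unit `lit-balaban-p39-g14`
(Phase-2 proof seat p39, gen 14), HOME `run/shared/lean/pub/lit-balaban/`, 2026-08-22.

References: [Balaban1983Higgs3] T. Bałaban, CMP 88 (1983) 411–445, (2.24)–(2.28) pp. 430–431; [GlimmJaffeQP1987] J. Glimm,
A. Jaffe, *Quantum Physics*, 2nd ed. (1987), Thm 6.3.1, Prop. 8.3.1, Cor. 8.3.2.
-/

noncomputable section

open scoped BigOperators InnerProductSpace

namespace Literature.MathematicalPhysics.QuantumFieldTheory.Balaban1983to89.B3WT228Phi2Graphs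

open _root_.MeasureTheory
open EuclideanSpace (basisFun)
open LatticeFieldCalculus B3WT223Instance B3WT224Instance B3WTPropagator B3WTCovariance B3WTWick B3WT226Pairings
  B3WT226Derivative B3WT226Traces B3WT228Left B3WickVertexCalculus B3WT228Graphs

variable {P : Params} {j N : ℕ} (C : HiggsLattice.ChargeData N) (η w c M2 : ℝ)

/-! ## §1 One-loop Gaussian evaluations with the `:|φ(x)|²:` insertion -/

/-- **the seagull tadpole opened at `x`**: `∫W :|φ(x)|²:_{C} ⟪φ(y),Qφ(y')⟫ = 2·C(y,x)C(y',x)·tr Q·Z` for every operator `Q`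
(both legs of `:|φ(x)|²:` contracted into the bilinear vertex; `Σ_a⟪e_a,Qe_a⟫ = tr Q = B3WTCovariance.trE Q`).
[cite: Balaban1983Higgs3, (2.28) p.431] -/
theorem integral_wick2_biq (hw : 0 < w) (hM : 0 < M2) (x y y' : Site P j)
    (Q : EuclideanSpace ℝ (Fin N) →L[ℝ] EuclideanSpace ℝ (Fin N)) :
    ∫ φ, weight C η w c M2 0 φ * (wick2 w c M2 x φ * ⟪φ y, Q (φ y')⟫_ℝ) =
      2 * (G w c M2 y x * G w c M2 y' x * trE Q) * ∫ φ : Cfg P j N, weight C η w c M2 0 φ := by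
  rw [integral_wick2_mul C η w c M2 hw hM x (R := fun φ => ⟪φ y, Q (φ y')⟫_ℝ)
    (R₁ := fun a φ => G w c M2 y x * ⟪basisFun (Fin N) ℝ a, Q (φ y')⟫_ℝ + G w c M2 y' x * ⟪φ y, Q (basisFun (Fin N) ℝ a)⟫_ℝ)
    (R₂ := fun a _ => G w c M2 y x * G w c M2 y' x *
      (⟪basisFun (Fin N) ℝ a, Q (basisFun (Fin N) ℝ a)⟫_ℝ + ⟪basisFun (Fin N) ℝ a, Q (basisFun (Fin N) ℝ a)⟫_ℝ))
    (expGrowth_biq y y' Q) (fun a => expGrowth_dbiq w c M2 x a y y' Q) (fun _ => ExpGrowth.const _)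
    (fun a => derivAlong_biq w c M2 x a y y' Q) (fun a => derivAlong_dbiq w c M2 x a a y y' Q)]
  simp_rw [integral_mul_const]
  rw [trE, Finset.mul_sum, Finset.mul_sum, Finset.sum_mul]
  exact Finset.sum_congr rfl fun a _ => by ring

/-- **four covariances at once**: `∫W (a₁⟪φ(u₁),v⟫ − a₂⟪φ(u₂),v⟫)(b₁⟪φ(u₃),v'⟫ − b₂⟪φ(u₄),v'⟫)
= Z·(a₁b₁C(u₁,u₃) − a₁b₂C(u₁,u₄) − a₂b₁C(u₂,u₃) + a₂b₂C(u₂,u₄))·⟪v,v'⟫` (`B3WTCovariance.moment2`). [cite: Balaban1983Higgs3, (2.26) p.431] -/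
theorem moment2_lin_comb (hw : 0 < w) (hM : 0 < M2) (u₁ u₂ u₃ u₄ : Site P j) (a₁ a₂ b₁ b₂ : ℝ)
    (v v' : EuclideanSpace ℝ (Fin N)) :
    ∫ φ, weight C η w c M2 0 φ * ((a₁ * ⟪φ u₁, v⟫_ℝ - a₂ * ⟪φ u₂, v⟫_ℝ) * (b₁ * ⟪φ u₃, v'⟫_ℝ - b₂ * ⟪φ u₄, v'⟫_ℝ)) =
      (∫ φ : Cfg P j N, weight C η w c M2 0 φ) * ((a₁ * b₁ * G w c M2 u₁ u₃ - a₁ * b₂ * G w c M2 u₁ u₄ - a₂ * b₁ * G w c M2 u₂ u₃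
        + a₂ * b₂ * G w c M2 u₂ u₄) * ⟪v, v'⟫_ℝ) := by
  have i := fun (u u' : Site P j) (r : ℝ) =>
    (integrable_weight_mul_inner_inner C η w c M2 hw hM u u' v v').const_mul r
  have e1 : (fun φ => weight C η w c M2 0 φ * ((a₁ * ⟪φ u₁, v⟫_ℝ - a₂ * ⟪φ u₂, v⟫_ℝ) * (b₁ * ⟪φ u₃, v'⟫_ℝ - b₂ * ⟪φ u₄, v'⟫_ℝ))) =
      fun φ => ((a₁ * b₁) * (weight C η w c M2 0 φ * (⟪φ u₁, v⟫_ℝ * ⟪φ u₃, v'⟫_ℝ)) - (a₁ * b₂) * (weight C η w c M2 0 φ * (⟪φ u₁, v⟫_ℝ * ⟪φ u₄, v'⟫_ℝ)))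
        - ((a₂ * b₁) * (weight C η w c M2 0 φ * (⟪φ u₂, v⟫_ℝ * ⟪φ u₃, v'⟫_ℝ)) - (a₂ * b₂) * (weight C η w c M2 0 φ * (⟪φ u₂, v⟫_ℝ * ⟪φ u₄, v'⟫_ℝ))) := by
    funext φ; ring
  have j1 : Integrable (fun φ => (a₁ * b₁) * (weight C η w c M2 0 φ * (⟪φ u₁, v⟫_ℝ * ⟪φ u₃, v'⟫_ℝ))
      - (a₁ * b₂) * (weight C η w c M2 0 φ * (⟪φ u₁, v⟫_ℝ * ⟪φ u₄, v'⟫_ℝ))) := (i u₁ u₃ _).sub (i u₁ u₄ _)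
  have j2 : Integrable (fun φ => (a₂ * b₁) * (weight C η w c M2 0 φ * (⟪φ u₂, v⟫_ℝ * ⟪φ u₃, v'⟫_ℝ))
      - (a₂ * b₂) * (weight C η w c M2 0 φ * (⟪φ u₂, v⟫_ℝ * ⟪φ u₄, v'⟫_ℝ))) := (i u₂ u₃ _).sub (i u₂ u₄ _)
  rw [e1, integral_sub j1 j2, integral_sub (i u₁ u₃ _) (i u₁ u₄ _), integral_sub (i u₂ u₃ _) (i u₂ u₄ _),
    integral_const_mul, integral_const_mul, integral_const_mul, integral_const_mul, moment2 C η w c M2 hw hM,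
    moment2 C η w c M2 hw hM, moment2 C η w c M2 hw hM, moment2 C η w c M2 hw hM]
  ring

omit η in
/-- the derivative of the current vertex as a difference of two legs: `C(y₁,x)⟪e_a,qφ(y₂)⟫ + C(y₂,x)⟪φ(y₁),qe_a⟫
= C(y₂,x)⟪φ(y₁),qe_a⟫ − C(y₁,x)⟪φ(y₂),qe_a⟫` (`⟪e_a,qu⟫ = −⟪u,qe_a⟫`). [cite: Balaban1982Higgs1, (1.7) p.605] -/
theorem dJ_eq (x y₁ y₂ : Site P j) (a : Fin N) (φ : Cfg P j N) :
    G w c M2 y₁ x * ⟪basisFun (Fin N) ℝ a, C.q (φ y₂)⟫_ℝ + G w c M2 y₂ x * ⟪φ y₁, C.q (basisFun (Fin N) ℝ a)⟫_ℝ =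
      G w c M2 y₂ x * ⟪φ y₁, C.q (basisFun (Fin N) ℝ a)⟫_ℝ - G w c M2 y₁ x * ⟪φ y₂, C.q (basisFun (Fin N) ℝ a)⟫_ℝ := by
  have h : ⟪basisFun (Fin N) ℝ a, C.q (φ y₂)⟫_ℝ = -⟪φ y₂, C.q (basisFun (Fin N) ℝ a)⟫_ℝ := by
    rw [← real_inner_comm, inner_q_left]
  rw [h]; ring

omit η w c M2 in
/-- `Σ_a ⟪qe_a, qe_a⟫ = −tr q²` (`⟪qv,qv⟫ = −⟪v,q²v⟫`, `B3WT226Pairings.inner_q_q_self`). [cite: Balaban1983Higgs3, (2.26) p.431] -/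
theorem sum_inner_qe_qe : ∑ a : Fin N, ⟪C.q (basisFun (Fin N) ℝ a), C.q (basisFun (Fin N) ℝ a)⟫_ℝ = -trE (C.q.comp C.q) := by
  rw [trE, ← Finset.sum_neg_distrib]
  exact Finset.sum_congr rfl fun a _ => by rw [inner_q_q_self, ContinuousLinearMap.comp_apply]

/-- **the loop of (2.26) opened at `x`**: `Σ_a ∫W D_{x,a}J(y₁,y₂)·D_{x,a}J(y₃,y₄)
= −τZ·[C(y₁,x)C(y₃,x)C(y₂,y₄) − C(y₁,x)C(y₄,x)C(y₂,y₃) − C(y₂,x)C(y₃,x)C(y₁,y₄) + C(y₂,x)C(y₄,x)C(y₁,y₃)]`, `τ = tr q²`.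
[cite: Balaban1983Higgs3, (2.28) p.431] -/
theorem sum_integral_dJ_mul_dJ (hw : 0 < w) (hM : 0 < M2) (x y₁ y₂ y₃ y₄ : Site P j) :
    ∑ a : Fin N, ∫ φ, weight C η w c M2 0 φ *
      ((G w c M2 y₁ x * ⟪basisFun (Fin N) ℝ a, C.q (φ y₂)⟫_ℝ + G w c M2 y₂ x * ⟪φ y₁, C.q (basisFun (Fin N) ℝ a)⟫_ℝ) *
        (G w c M2 y₃ x * ⟪basisFun (Fin N) ℝ a, C.q (φ y₄)⟫_ℝ + G w c M2 y₄ x * ⟪φ y₃, C.q (basisFun (Fin N) ℝ a)⟫_ℝ)) =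
      -trE (C.q.comp C.q) * (∫ φ : Cfg P j N, weight C η w c M2 0 φ) *
        (G w c M2 y₁ x * G w c M2 y₃ x * G w c M2 y₂ y₄ - G w c M2 y₁ x * G w c M2 y₄ x * G w c M2 y₂ y₃
          - G w c M2 y₂ x * G w c M2 y₃ x * G w c M2 y₁ y₄ + G w c M2 y₂ x * G w c M2 y₄ x * G w c M2 y₁ y₃) := by
  simp_rw [dJ_eq C w c M2, moment2_lin_comb C η w c M2 hw hM]
  rw [← Finset.mul_sum, ← Finset.mul_sum, sum_inner_qe_qe C]
  ring

/-- `∫W :|φ(x)|²: J·K = 2Σ_a∫W D_{x,a}J·D_{x,a}K` for two vertices with vanishing second derivatives (both legs of `:|φ(x)|²:` go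
one into each factor). [cite: GlimmJaffeQP1987, Cor. 8.3.2 (8.3.8)–(8.3.9)] -/
theorem integral_wick2_mul_prod (hw : 0 < w) (hM : 0 < M2) (x : Site P j) {J K : Cfg P j N → ℝ}
    {dJ dK : Fin N → Cfg P j N → ℝ} (hJ : ExpGrowth J) (hK : ExpGrowth K) (hdJ : ∀ a, ExpGrowth (dJ a))
    (hdK : ∀ a, ExpGrowth (dK a)) (DJ : ∀ a, DerivAlong (hx w c M2 x a) J (dJ a))
    (DK : ∀ a, DerivAlong (hx w c M2 x a) K (dK a)) (DdJ : ∀ a b, DerivAlong (hx w c M2 x b) (dJ a) (fun _ => 0))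
    (DdK : ∀ a b, DerivAlong (hx w c M2 x b) (dK a) (fun _ => 0)) :
    ∫ φ, weight C η w c M2 0 φ * (wick2 w c M2 x φ * (J φ * K φ)) = 2 * ∑ a : Fin N, ∫ φ, weight C η w c M2 0 φ * (dJ a φ * dK a φ) := by
  rw [integral_wick2_mul C η w c M2 hw hM x (R := fun φ => J φ * K φ)
    (R₁ := fun a φ => dJ a φ * K φ + J φ * dK a φ)
    (R₂ := fun a φ => (0 * K φ + dJ a φ * dK a φ) + (dJ a φ * dK a φ + J φ * 0))
    (hJ.mul hK) (fun a => ((hdJ a).mul hK).add (hJ.mul (hdK a)))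
    (fun a => (((ExpGrowth.const 0).mul hK).add ((hdJ a).mul (hdK a))).add
      (((hdJ a).mul (hdK a)).add (hJ.mul (ExpGrowth.const 0))))
    (fun a => (DJ a).mul (DK a)) (fun a => ((DdJ a a).mul (DK a)).add ((DJ a).mul (DdK a a))), Finset.mul_sum]
  refine Finset.sum_congr rfl fun a _ => ?_
  rw [← integral_const_mul]
  exact integral_congr_ae (Filter.Eventually.of_forall fun φ => by ring)

/-- **the two-propagator loop of (2.26) with the `:|φ(x)|²:` insertion**:
`∫W :|φ(x)|²:⟪φ(y₁),qφ(y₂)⟫⟪φ(y₃),qφ(y₄)⟫ = −2τZ·[C(y₁,x)C(y₃,x)C(y₂,y₄) − C(y₁,x)C(y₄,x)C(y₂,y₃) − C(y₂,x)C(y₃,x)C(y₁,y₄)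
+ C(y₂,x)C(y₄,x)C(y₁,y₃)]` — compare `B3WTWick.moment_qq` (`= τZ·[C(y₁,y₄)C(y₂,y₃) − C(y₁,y₃)C(y₂,y₄)]`): each line of the loop
in turn opened at `x` (the triangle graphs current–`:φ²:`–current). [cite: Balaban1983Higgs3, (2.28) p.431] -/
theorem integral_wick2_JJ (hw : 0 < w) (hM : 0 < M2) (x y₁ y₂ y₃ y₄ : Site P j) :
    ∫ φ, weight C η w c M2 0 φ * (wick2 w c M2 x φ * (⟪φ y₁, C.q (φ y₂)⟫_ℝ * ⟪φ y₃, C.q (φ y₄)⟫_ℝ)) =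
      -2 * trE (C.q.comp C.q) * (∫ φ : Cfg P j N, weight C η w c M2 0 φ) *
        (G w c M2 y₁ x * G w c M2 y₃ x * G w c M2 y₂ y₄ - G w c M2 y₁ x * G w c M2 y₄ x * G w c M2 y₂ y₃
          - G w c M2 y₂ x * G w c M2 y₃ x * G w c M2 y₁ y₄ + G w c M2 y₂ x * G w c M2 y₄ x * G w c M2 y₁ y₃) := by
  rw [integral_wick2_mul_prod C η w c M2 hw hM x (J := fun φ => ⟪φ y₁, C.q (φ y₂)⟫_ℝ)
    (K := fun φ => ⟪φ y₃, C.q (φ y₄)⟫_ℝ)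
    (dJ := fun a φ => G w c M2 y₁ x * ⟪basisFun (Fin N) ℝ a, C.q (φ y₂)⟫_ℝ + G w c M2 y₂ x * ⟪φ y₁, C.q (basisFun (Fin N) ℝ a)⟫_ℝ)
    (dK := fun a φ => G w c M2 y₃ x * ⟪basisFun (Fin N) ℝ a, C.q (φ y₄)⟫_ℝ + G w c M2 y₄ x * ⟪φ y₃, C.q (basisFun (Fin N) ℝ a)⟫_ℝ)
    (expGrowth_biq y₁ y₂ C.q) (expGrowth_biq y₃ y₄ C.q) (fun a => expGrowth_dbiq w c M2 x a y₁ y₂ C.q)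
    (fun a => expGrowth_dbiq w c M2 x a y₃ y₄ C.q) (fun a => derivAlong_biq w c M2 x a y₁ y₂ C.q)
    (fun a => derivAlong_biq w c M2 x a y₃ y₄ C.q) (fun a b => derivAlong_dJ_zero C w c M2 x a b y₁ y₂)
    (fun a b => derivAlong_dJ_zero C w c M2 x a b y₃ y₄), sum_integral_dJ_mul_dJ C η w c M2 hw hM]
  ring

/-! ## §2 The left member for `F = :|φ(x)|²:` -/

omit C η in
/-- `:|φ(x)|²:` as a local even polynomial of `B3WT228Left`: `η^d:|φ(x)|²: = Σ_yη^d(0·|φ(y)|⁴ + 𝟙_{x}(y)|φ(y)|² − N·C(x,x)𝟙_{x}(y))`.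
[cite: Balaban1983Higgs3, (2.24) p.430 (the admissible F)] -/
theorem localEvenPoly_single_wick2 (x : Site P j) (φ : Cfg P j N) :
    (∑ y : Site P j, w * ((0 : ℝ) * ‖φ y‖ ^ 4 + (if y = x then 1 else 0) * ‖φ y‖ ^ 2
      + (if y = x then -(N * G w c M2 x x) else 0))) = w * wick2 w c M2 x φ := by
  rw [Finset.sum_eq_single x (fun y _ hy => by simp [hy]) (fun h => (h (Finset.mem_univ x)).elim), wick2_def,
    if_pos rfl, if_pos rfl]
  ring

/-- **the LEFT member for `F = :|φ(x)|²:`** (*"Taking other functions F"*; the functions `−½δm²_l(x):|φ(x)|²:`,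
`−λ_kC^η_{M²}(0):|φ(x)|²:` of p. 430 are weighted sums over `x` of this one):
`∫W :|φ(x)|²:[(−cηe⟨∂^ηφ,Bqφ⟩)⟨∂^ηφ,∂^ηλqφ⟩ − cηe⟨φ,B·∂^ηλq²φ⟩ − ηe⟨∂^ηφ,B∂^ηλq²φ⟩] = 0` — `B3WT228Left.eq228_deriv` with
`α = 0`, `β = 𝟙_{x}`, `γ = −N·C(x,x)𝟙_{x}`. [cite: Balaban1983Higgs3, (2.28) p.431] -/
theorem eq228_phi2_left (hw : 0 < w) (hM : 0 < M2) (hce : c * η * C.e ≠ 0) (x : Site P j) (B : VecField P j ℝ)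
    (lam : Site P j → ℝ) :
    ∫ φ, weight C η w c M2 0 φ * (wick2 w c M2 x φ *
      ((-(c * η * C.e) * curJ C w c B φ) * pairD C w c lam φ - (c * η * C.e) * locQ C w c B lam φ
        - (η * C.e) * derQ C w c B lam φ)) = 0 := by
  have h := eq228_deriv C η w c M2 hw hM hce B lam (fun _ => 0) (fun y => if y = x then 1 else 0)
    (fun y => if y = x then -(N * G w c M2 x x) else 0)
  simp_rw [localEvenPoly_single_wick2 w c M2 x] at h
  have e : (fun φ => weight C η w c M2 0 φ * (w * wick2 w c M2 x φ *
      ((-(c * η * C.e) * curJ C w c B φ) * pairD C w c lam φ - (c * η * C.e) * locQ C w c B lam φ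
        - (η * C.e) * derQ C w c B lam φ))) = fun φ => w * (weight C η w c M2 0 φ * (wick2 w c M2 x φ *
      ((-(c * η * C.e) * curJ C w c B φ) * pairD C w c lam φ - (c * η * C.e) * locQ C w c B lam φ
        - (η * C.e) * derQ C w c B lam φ))) := by
    funext φ; ring
  rw [e, integral_const_mul] at h
  exact (mul_eq_zero.mp h).resolve_left hw.ne'

/-! ## §3 The Gaussian evaluation and the drawn identity -/

/-- `∫W :|φ(x)|²:⟨∂^ηφ,Bqφ⟩⟨∂^ηφ,∂^ηλqφ⟩` as the sum over the two current vertices of the opened loops.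
[cite: Balaban1983Higgs3, (2.28) p.431] -/
theorem integral_wick2_curJ_pairD (hw : 0 < w) (hM : 0 < M2) (x : Site P j) (B : VecField P j ℝ) (lam : Site P j → ℝ) :
    ∫ φ, weight C η w c M2 0 φ * (wick2 w c M2 x φ * (curJ C w c B φ * pairD C w c lam φ)) =
      ∑ b : PBond P j, ∑ b' : PBond P j, (w * B b * c) * (w * grad c lam b' * c) *
        (-2 * trE (C.q.comp C.q) * (∫ φ : Cfg P j N, weight C η w c M2 0 φ) *
          (G w c M2 b.src x * G w c M2 b'.src x * G w c M2 b.tgt b'.tgt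
            - G w c M2 b.src x * G w c M2 b'.tgt x * G w c M2 b.tgt b'.src
            - G w c M2 b.tgt x * G w c M2 b'.src x * G w c M2 b.src b'.tgt
            + G w c M2 b.tgt x * G w c M2 b'.tgt x * G w c M2 b.src b'.src)) := by
  have e1 : (fun φ => weight C η w c M2 0 φ * (wick2 w c M2 x φ * (curJ C w c B φ * pairD C w c lam φ))) =
      fun φ => ∑ b : PBond P j, ∑ b' : PBond P j, (w * B b * c) * (w * grad c lam b' * c) *
        (weight C η w c M2 0 φ * (wick2 w c M2 x φ * (⟪φ b.src, C.q (φ b.tgt)⟫_ℝ * ⟪φ b'.src, C.q (φ b'.tgt)⟫_ℝ))) := by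
    funext φ
    rw [curJ_mul_pairD_expand, Finset.mul_sum, Finset.mul_sum]
    refine Finset.sum_congr rfl fun b _ => ?_
    rw [Finset.mul_sum, Finset.mul_sum]
    exact Finset.sum_congr rfl fun b' _ => by ring
  have hi : ∀ b b' : PBond P j, Integrable (fun φ => (w * B b * c) * (w * grad c lam b' * c) *
      (weight C η w c M2 0 φ * (wick2 w c M2 x φ * (⟪φ b.src, C.q (φ b.tgt)⟫_ℝ * ⟪φ b'.src, C.q (φ b'.tgt)⟫_ℝ)))) := fun b b' =>
    (((expGrowth_wick2 w c M2 x).mul ((expGrowth_biq b.src b.tgt C.q).mul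
      (expGrowth_biq b'.src b'.tgt C.q))).integrable C η w c M2 hw hM).const_mul _
  rw [e1, integral_finsetSum _ (fun b _ => integrable_finsetSum _ fun b' _ => hi b b')]
  refine Finset.sum_congr rfl fun b _ => ?_
  rw [integral_finsetSum _ (fun b' _ => hi b b')]
  exact Finset.sum_congr rfl fun b' _ => by rw [integral_const_mul, integral_wick2_JJ C η w c M2 hw hM]

/-- `∫W :|φ(x)|²:⟨φ,B·∂^ηλq²φ⟩ = Σ_bη^dB_b(∂^ηλ)(b)·2τC(b₋,x)²·Z` (the tadpole of the third (2.27) picture opened at `x`).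
[cite: Balaban1983Higgs3, (2.28) p.431] -/
theorem integral_wick2_locQ (hw : 0 < w) (hM : 0 < M2) (x : Site P j) (B : VecField P j ℝ) (lam : Site P j → ℝ) :
    ∫ φ, weight C η w c M2 0 φ * (wick2 w c M2 x φ * locQ C w c B lam φ) =
      ∑ b : PBond P j, (w * (B b * grad c lam b)) *
        (2 * (G w c M2 b.src x * G w c M2 b.src x * trE (C.q.comp C.q)) * ∫ φ : Cfg P j N, weight C η w c M2 0 φ) := by
  have e1 : (fun φ => weight C η w c M2 0 φ * (wick2 w c M2 x φ * locQ C w c B lam φ)) =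
      fun φ => ∑ b : PBond P j, (w * (B b * grad c lam b)) *
        (weight C η w c M2 0 φ * (wick2 w c M2 x φ * ⟪φ b.src, (C.q.comp C.q) (φ b.src)⟫_ℝ)) := by
    funext φ
    unfold locQ
    rw [Finset.mul_sum, Finset.mul_sum]
    exact Finset.sum_congr rfl fun b _ => by rw [ContinuousLinearMap.comp_apply]; ring
  have hi : ∀ b : PBond P j, Integrable (fun φ => (w * (B b * grad c lam b)) *
      (weight C η w c M2 0 φ * (wick2 w c M2 x φ * ⟪φ b.src, (C.q.comp C.q) (φ b.src)⟫_ℝ))) := fun b =>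
    (((expGrowth_wick2 w c M2 x).mul (expGrowth_biq b.src b.src _)).integrable C η w c M2 hw hM).const_mul _
  rw [e1, integral_finsetSum _ (fun b _ => hi b)]
  exact Finset.sum_congr rfl fun b _ => by rw [integral_const_mul, integral_wick2_biq C η w c M2 hw hM]

/-- `∫W :|φ(x)|²:⟨∂^ηφ,B∂^ηλq²φ⟩ = Σ_bη^dB_b(∂^ηλ)(b)c·2τ(C(b₊,x)C(b₋,x) − C(b₋,x)²)·Z` (the fourth (2.27) picture opened at `x`).
[cite: Balaban1983Higgs3, (2.28) p.431] -/
theorem integral_wick2_derQ (hw : 0 < w) (hM : 0 < M2) (x : Site P j) (B : VecField P j ℝ) (lam : Site P j → ℝ) :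
    ∫ φ, weight C η w c M2 0 φ * (wick2 w c M2 x φ * derQ C w c B lam φ) =
      ∑ b : PBond P j, ((w * (B b * grad c lam b) * c) *
        (2 * (G w c M2 b.tgt x * G w c M2 b.src x * trE (C.q.comp C.q)) * ∫ φ : Cfg P j N, weight C η w c M2 0 φ)
          - (w * (B b * grad c lam b) * c) * (2 * (G w c M2 b.src x * G w c M2 b.src x * trE (C.q.comp C.q)) * ∫ φ : Cfg P j N, weight C η w c M2 0 φ)) := by
  have e1 : (fun φ => weight C η w c M2 0 φ * (wick2 w c M2 x φ * derQ C w c B lam φ)) =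
      fun φ => ∑ b : PBond P j, ((w * (B b * grad c lam b) * c) *
        (weight C η w c M2 0 φ * (wick2 w c M2 x φ * ⟪φ b.tgt, (C.q.comp C.q) (φ b.src)⟫_ℝ))
          - (w * (B b * grad c lam b) * c) * (weight C η w c M2 0 φ * (wick2 w c M2 x φ * ⟪φ b.src, (C.q.comp C.q) (φ b.src)⟫_ℝ))) := by
    funext φ
    rw [derQ_expand, Finset.mul_sum, Finset.mul_sum]
    exact Finset.sum_congr rfl fun b _ => by ring
  have hi1 : ∀ b : PBond P j, Integrable (fun φ => (w * (B b * grad c lam b) * c) *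
      (weight C η w c M2 0 φ * (wick2 w c M2 x φ * ⟪φ b.tgt, (C.q.comp C.q) (φ b.src)⟫_ℝ))) := fun b =>
    (((expGrowth_wick2 w c M2 x).mul (expGrowth_biq b.tgt b.src _)).integrable C η w c M2 hw hM).const_mul _
  have hi2 : ∀ b : PBond P j, Integrable (fun φ => (w * (B b * grad c lam b) * c) *
      (weight C η w c M2 0 φ * (wick2 w c M2 x φ * ⟪φ b.src, (C.q.comp C.q) (φ b.src)⟫_ℝ))) := fun b =>
    (((expGrowth_wick2 w c M2 x).mul (expGrowth_biq b.src b.src _)).integrable C η w c M2 hw hM).const_mul _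
  have hi : ∀ b : PBond P j, Integrable (fun φ => (w * (B b * grad c lam b) * c) *
      (weight C η w c M2 0 φ * (wick2 w c M2 x φ * ⟪φ b.tgt, (C.q.comp C.q) (φ b.src)⟫_ℝ))
        - (w * (B b * grad c lam b) * c) * (weight C η w c M2 0 φ * (wick2 w c M2 x φ * ⟪φ b.src, (C.q.comp C.q) (φ b.src)⟫_ℝ))) :=
    fun b => (hi1 b).sub (hi2 b)
  rw [e1, integral_finsetSum _ (fun b _ => hi b)]
  exact Finset.sum_congr rfl fun b _ => by
    rw [integral_sub (hi1 b) (hi2 b), integral_const_mul, integral_const_mul,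
      integral_wick2_biq C η w c M2 hw hM, integral_wick2_biq C η w c M2 hw hM]

/-- **the Gaussian evaluation of the `:|φ(x)|²:`-identity as one-loop graphs**: `∫W :|φ(x)|²:[…] = Z·𝒢(x)` where `𝒢(x)` is the
explicit sum displayed in the statement — `−cηe Σ_{b,b'}(η^dB_bc)(η^d(∂^ηλ)(b')c)·(−2τ)[C(b₋,x)C(b'₋,x)C(b₊,b'₊) − C(b₋,x)C(b'₊,x)C(b₊,b'₋)
− C(b₊,x)C(b'₋,x)C(b₋,b'₊) + C(b₊,x)C(b'₊,x)C(b₋,b'₋)]` (triangles) `− cηe Σ_bη^dB_b(∂^ηλ)(b)·2τC(b₋,x)²`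
`− ηe Σ_bη^dB_b(∂^ηλ)(b)c·2τ[C(b₊,x)C(b₋,x) − C(b₋,x)²]` (opened tadpoles), `τ = tr q²`. [cite: Balaban1983Higgs3, (2.28) p.431] -/
theorem eq228_phi2_wick (hw : 0 < w) (hM : 0 < M2) (x : Site P j) (B : VecField P j ℝ) (lam : Site P j → ℝ) :
    ∫ φ, weight C η w c M2 0 φ * (wick2 w c M2 x φ *
      ((-(c * η * C.e) * curJ C w c B φ) * pairD C w c lam φ - (c * η * C.e) * locQ C w c B lam φ
        - (η * C.e) * derQ C w c B lam φ)) =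
      (∫ φ : Cfg P j N, weight C η w c M2 0 φ) *
        (-(c * η * C.e) * ∑ b : PBond P j, ∑ b' : PBond P j, (w * B b * c) * (w * grad c lam b' * c) *
            (-2 * trE (C.q.comp C.q) *
              (G w c M2 b.src x * G w c M2 b'.src x * G w c M2 b.tgt b'.tgt
                - G w c M2 b.src x * G w c M2 b'.tgt x * G w c M2 b.tgt b'.src
                - G w c M2 b.tgt x * G w c M2 b'.src x * G w c M2 b.src b'.tgt
                + G w c M2 b.tgt x * G w c M2 b'.tgt x * G w c M2 b.src b'.src))
          - (c * η * C.e) * ∑ b : PBond P j, (w * (B b * grad c lam b)) *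
            (2 * trE (C.q.comp C.q) * G w c M2 b.src x ^ 2)
          - (η * C.e) * ∑ b : PBond P j, (w * (B b * grad c lam b) * c) *
            (2 * trE (C.q.comp C.q) * (G w c M2 b.tgt x * G w c M2 b.src x - G w c M2 b.src x ^ 2))) := by
  have i1 : Integrable (fun φ => weight C η w c M2 0 φ * (wick2 w c M2 x φ * (curJ C w c B φ * pairD C w c lam φ))) :=
    ((expGrowth_wick2 w c M2 x).mul ((expGrowth_curJ C w c B).mul (expGrowth_pairD C w c lam))).integrable C η w c M2 hw hM
  have i2 : Integrable (fun φ => weight C η w c M2 0 φ * (wick2 w c M2 x φ * locQ C w c B lam φ)) :=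
    ((expGrowth_wick2 w c M2 x).mul (expGrowth_locQ C w c B lam)).integrable C η w c M2 hw hM
  have i3 : Integrable (fun φ => weight C η w c M2 0 φ * (wick2 w c M2 x φ * derQ C w c B lam φ)) :=
    ((expGrowth_wick2 w c M2 x).mul (expGrowth_derQ C w c B lam)).integrable C η w c M2 hw hM
  have e1 : (fun φ => weight C η w c M2 0 φ * (wick2 w c M2 x φ *
      ((-(c * η * C.e) * curJ C w c B φ) * pairD C w c lam φ - (c * η * C.e) * locQ C w c B lam φ
        - (η * C.e) * derQ C w c B lam φ))) = fun φ =>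
      (-(c * η * C.e) * (weight C η w c M2 0 φ * (wick2 w c M2 x φ * (curJ C w c B φ * pairD C w c lam φ)))
        - (c * η * C.e) * (weight C η w c M2 0 φ * (wick2 w c M2 x φ * locQ C w c B lam φ)))
        - (η * C.e) * (weight C η w c M2 0 φ * (wick2 w c M2 x φ * derQ C w c B lam φ)) := by
    funext φ; ring
  have j12 : Integrable (fun φ => -(c * η * C.e) * (weight C η w c M2 0 φ * (wick2 w c M2 x φ * (curJ C w c B φ * pairD C w c lam φ)))
      - (c * η * C.e) * (weight C η w c M2 0 φ * (wick2 w c M2 x φ * locQ C w c B lam φ))) := (i1.const_mul _).sub (i2.const_mul _)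
  rw [e1, integral_sub j12 (i3.const_mul _), integral_sub (i1.const_mul _) (i2.const_mul _), integral_const_mul,
    integral_const_mul, integral_const_mul, integral_wick2_curJ_pairD C η w c M2 hw hM, integral_wick2_locQ C η w c M2 hw hM,
    integral_wick2_derQ C η w c M2 hw hM]
  set Z : ℝ := ∫ φ : Cfg P j N, weight C η w c M2 0 φ with hZ
  set τ : ℝ := trE (C.q.comp C.q) with hτ
  have k1 : (∑ b : PBond P j, ∑ b' : PBond P j, (w * B b * c) * (w * grad c lam b' * c) *
      (-2 * τ * Z *
        (G w c M2 b.src x * G w c M2 b'.src x * G w c M2 b.tgt b'.tgt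
          - G w c M2 b.src x * G w c M2 b'.tgt x * G w c M2 b.tgt b'.src
          - G w c M2 b.tgt x * G w c M2 b'.src x * G w c M2 b.src b'.tgt
          + G w c M2 b.tgt x * G w c M2 b'.tgt x * G w c M2 b.src b'.src))) =
      Z * ∑ b : PBond P j, ∑ b' : PBond P j, (w * B b * c) * (w * grad c lam b' * c) *
        (-2 * τ *
          (G w c M2 b.src x * G w c M2 b'.src x * G w c M2 b.tgt b'.tgt
            - G w c M2 b.src x * G w c M2 b'.tgt x * G w c M2 b.tgt b'.src
            - G w c M2 b.tgt x * G w c M2 b'.src x * G w c M2 b.src b'.tgt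
            + G w c M2 b.tgt x * G w c M2 b'.tgt x * G w c M2 b.src b'.src)) := by
    rw [Finset.mul_sum]
    refine Finset.sum_congr rfl fun b _ => ?_
    rw [Finset.mul_sum]
    exact Finset.sum_congr rfl fun b' _ => by ring
  have k2 : (∑ b : PBond P j, (w * (B b * grad c lam b)) *
      (2 * (G w c M2 b.src x * G w c M2 b.src x * τ) * Z)) =
      Z * ∑ b : PBond P j, (w * (B b * grad c lam b)) * (2 * τ * G w c M2 b.src x ^ 2) := by
    rw [Finset.mul_sum]
    exact Finset.sum_congr rfl fun b _ => by ring
  have k3 : (∑ b : PBond P j, ((w * (B b * grad c lam b) * c) *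
        (2 * (G w c M2 b.tgt x * G w c M2 b.src x * τ) * Z)
          - (w * (B b * grad c lam b) * c) * (2 * (G w c M2 b.src x * G w c M2 b.src x * τ) * Z))) =
      Z * ∑ b : PBond P j, (w * (B b * grad c lam b) * c) *
        (2 * τ * (G w c M2 b.tgt x * G w c M2 b.src x - G w c M2 b.src x ^ 2)) := by
    rw [Finset.mul_sum]
    exact Finset.sum_congr rfl fun b _ => by ring
  rw [k1, k2, k3]
  ring

/-- **THE WARD–TAKAHASHI IDENTITY FOR `F = :|φ(x)|²:` DRAWN** (*"Taking other functions F … we can get all necessary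
Ward-Takahashi identities. … Each such identity is connected with some set of graphs"*): for every site `x`, direction `B` and
gauge function `λ` (`η^d = w > 0`, `M² > 0`, `cηe ≠ 0`, `τ = tr q²`, `C = C^η_{M²}`), the one-loop graphs with the two-leg vertex at `x`
sum to zero:
`−cηe Σ_{b,b'}η^{2d}B_b(∂^ηλ)(b')c²·(−2τ)[C(b₋,x)C(b'₋,x)C(b₊,b'₊) − C(b₋,x)C(b'₊,x)C(b₊,b'₋) − C(b₊,x)C(b'₋,x)C(b₋,b'₊) + C(b₊,x)C(b'₊,x)C(b₋,b'₋)]`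
`− cηe Σ_bη^dB_b(∂^ηλ)(b)·2τC(b₋,x)² − ηe Σ_bη^dB_b(∂^ηλ)(b)c·2τ[C(b₊,x)C(b₋,x) − C(b₋,x)²] = 0`
— the left member vanishes by (2.24) (`eq228_phi2_left`), and equals `Z` times this sum (`eq228_phi2_wick`), `Z > 0`.
[cite: Balaban1983Higgs3, (2.28) p.431] -/
theorem eq228_phi2 (hw : 0 < w) (hM : 0 < M2) (hce : c * η * C.e ≠ 0) (x : Site P j) (B : VecField P j ℝ)
    (lam : Site P j → ℝ) :
    -(c * η * C.e) * ∑ b : PBond P j, ∑ b' : PBond P j, (w * B b * c) * (w * grad c lam b' * c) *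
        (-2 * trE (C.q.comp C.q) *
          (G w c M2 b.src x * G w c M2 b'.src x * G w c M2 b.tgt b'.tgt
            - G w c M2 b.src x * G w c M2 b'.tgt x * G w c M2 b.tgt b'.src
            - G w c M2 b.tgt x * G w c M2 b'.src x * G w c M2 b.src b'.tgt
            + G w c M2 b.tgt x * G w c M2 b'.tgt x * G w c M2 b.src b'.src))
      - (c * η * C.e) * ∑ b : PBond P j, (w * (B b * grad c lam b)) * (2 * trE (C.q.comp C.q) * G w c M2 b.src x ^ 2)
      - (η * C.e) * ∑ b : PBond P j, (w * (B b * grad c lam b) * c) *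
        (2 * trE (C.q.comp C.q) * (G w c M2 b.tgt x * G w c M2 b.src x - G w c M2 b.src x ^ 2)) = 0 := by
  have h := (eq228_phi2_wick C η w c M2 hw hM x B lam).symm.trans (eq228_phi2_left C η w c M2 hw hM hce x B lam)
  exact (mul_eq_zero.mp h).resolve_left (Z_pos C η w c M2 hw hM).ne'

end Literature.MathematicalPhysics.QuantumFieldTheory.Balaban1983to89.B3WT228Phi2Graphs

end
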